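import Literature.Barriers.BirchSwinnertonDyer.PAdicFunctionalEquationParityAnyPrimeProofs
import Literature.NumberTheory.EllipticCurves.GreenbergVatsal2000.MultiplicativeReduction
import HarnessLib

/-!
# Burungale–Skinner 2023, Proposition 2.2 — PROVED: `ε(E) = (−1)^{λ(L_E)}`

A. Burungale, C. Skinner, *A note on rank one quadratic twists of elliptic curves and the
non-degeneracy of `p`-adic regulators at Eisenstein primes*, Proc. AMS Ser. B 10 (2023) 13–32,
§2.1.1, **Proposition 2.2** (p. 17): "The root number `ε(E)` of `E` equals `(−1)^{λ(L_E)}`."  Proof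
in print: write the Weierstrass preparation `L_E = p^μ f u`; the functional equation
`L_E(T) = ε(E)(1+T)^{log_p N/log_p ρ(γ₀)} L_E(−T/(1+T))` [27, Ch. I (18.3)] reduced modulo
`p^{μ+1}` compares `p^μ u₀ T^λ` with `ε(E) p^μ (−1)^λ u₀ T^λ`, whence `ε(E)(−1)^λ = 1`.

This file proves the statement in the kernel, in the `μ = 0` currency of the tree (the only case
used in the paper: `μ(L_{E^ψ}) = 0` by Lemma 2.3 (i), and `λ = ord_T(L_E mod p)` when `μ = 0`), for
EVERY integral rescaling of the tree's `p`-adic `L`-function: if `b ∈ Λ = ℤ_p⟦T⟧` has unit content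
(`μ(b) = 0`) and `ι b = t · L_p(f, α, T)` for the newform `f` of the globally minimal `W` at the
conductor level, `α = unitRoot W p`, `t ∈ ℚ_p` (the Néron normalisation `t = ϖ`, `ϖ·Ω_E = Ω⁺_f`, of
Greenberg–Vatsal / BS §2.1.1 is one instance), then

  `w_E = (−1)^{ord_T(b mod p)}`   (`rootNumber_eq_neg_one_pow_order_map_toZMod`),

for any ODD prime `p` of good ordinary reduction. The functional equation is the tree THEOREM
`padicLFunction_mem_padicFEClass_rootNumber_conductorLevel` (`L_p(E,T^ι) = w_E (1+T)^c L_p(E,T)`,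
`T^ι = (1+T)^{-1} − 1`; Greenberg, LNM 1716, §1 — the same equation as [27, Ch. I (18.3)] in the
variable `T`), transported to `Λ` by the injectivity of `ι` and reduced modulo `p`, where the
leading-coefficient comparison is the tree lemma `eq_neg_one_pow_of_subst_eq` in the domain
`𝔽_p⟦T⟧`; lifting `w_E = (−1)^λ` from `𝔽_p` to `ℤ` uses `p ≠ 2`. Corollaries: `λ` even iff
`w_E = +1` iff `ord_{s=1} L(E,s)` even (`even_order_map_toZMod_iff_even_analyticRank`, with Hecke's
sign via `even_analyticRank_iff_of_isNewformOf_conductorLevel`), and the instance used on p. 21 of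
the paper: `λ(L_E) = 1 ⇒ ε(E) = −1` and `ord_{s=1} L(E,s)` odd. Theorems only; no new facts.

References: [BurungaleSkinner2023] Prop. 2.2 (p. 17) and proof of Thm. 2.8 (p. 21);
[GreenbergLNM1716] §1 (pp. 67–68), §5 (p. 181); [MazurTateTeitelbaum1986Invent] §I.17–18.
-/

noncomputable section

open scoped MatrixGroups ModularForm

open CongruenceSubgroup PowerSeries WeierstrassCurve
  Literature.NumberTheory.EllipticCurves Literature.NumberTheory.EllipticCurves.ModularForms
  Literature.NumberTheory.EllipticCurves.GreenbergVatsal2000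
  Literature.Barriers.BirchSwinnertonDyer

namespace Literature.NumberTheory.EllipticCurves.BurungaleSkinner2023

/-! ### Transport of a `Λ`-adic functional equation along a ring homomorphism -/

section Transport

variable {R S : Type*} [CommRing R] [CommRing S]

/-- `T^ι = (1+T)^{-1} − 1` has integer coefficients, so it is preserved by every ring map.
[cite: GreenbergLNM1716, §1 (functional equation, `T^ι = (1+T)^{-1} - 1`)] -/
theorem map_invOnePlusSubOne (h : R →+* S) :
    PowerSeries.map h (invOnePlusSubOne : R⟦X⟧) = (invOnePlusSubOne : S⟦X⟧) := by
  ext n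
  simp only [coeff_map, coeff_invOnePlusSubOne]
  split_ifs <;> simp

/-- **A functional equation `g(T^ι) = w · u · g` is preserved by every ring map `h : R → S`**
(coefficientwise): `(h g)(T^ι) = h(w) · (h u) · (h g)` (Mathlib `PowerSeries.map_subst` and
`map_invOnePlusSubOne`). This is the step "reduce the functional equation modulo `p^{μ+1}`" of the
printed proof of Prop. 2.2. [cite: BurungaleSkinner2023, Prop. 2.2 (proof, p. 17)] -/
theorem subst_invOnePlusSubOne_map (h : R →+* S) {g u : R⟦X⟧} {w : R}
    (hFE : g.subst (invOnePlusSubOne : R⟦X⟧) = C w * u * g) :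
    (PowerSeries.map h g).subst (invOnePlusSubOne : S⟦X⟧) =
      C (h w) * PowerSeries.map h u * PowerSeries.map h g := by
  have hm := map_subst (hasSubst_invOnePlusSubOne (R := R)) (h := h) g
  have hι : MvPowerSeries.map h (invOnePlusSubOne : R⟦X⟧) = (invOnePlusSubOne : S⟦X⟧) :=
    map_invOnePlusSubOne h
  rw [hι] at hm
  change PowerSeries.map h (g.subst invOnePlusSubOne) = (PowerSeries.map h g).subst _ at hm
  rw [← hm, hFE, map_mul, map_mul, map_C]

end Transport

/-! ### Descent of the functional equation from `ℚ_p⟦T⟧` to `Λ` and reduction modulo `p` -/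

section Descent

variable {p : ℕ} [Fact p.Prime]

/-- `ι_Λ((1+T)^c) = (1+T)^c`: the binomial series with `ℤ_p`-exponent has `ℤ_p`-coefficients
(Mathlib `binomialSeries_coeff`). [cite: GreenbergLNM1716, §1 (the multiplier `⟨N_E⟩^{s-1} = (1+T)^c`)] -/
theorem iwasawaToPowerSeries_binomialSeries (c : ℤ_[p]) :
    iwasawaToPowerSeries p (PowerSeries.binomialSeries ℤ_[p] c) =
      PowerSeries.binomialSeries ℚ_[p] c := by
  change PowerSeries.map (algebraMap ℤ_[p] ℚ_[p]) _ = _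
  ext n
  rw [coeff_map, binomialSeries_coeff, binomialSeries_coeff, smul_eq_mul, mul_one, Algebra.smul_def,
    mul_one]

/-- **Descent to `Λ`.** If `L ∈ ℚ_p⟦T⟧` satisfies `L(T^ι) = w (1+T)^c L` and `ι b = t · L` for some
`b ∈ Λ`, `t ∈ ℚ_p`, then `b(T^ι) = w (1+T)^c b` in `Λ` (`ι` is injective and commutes with
substitution; `t` is a scalar). [cite: BurungaleSkinner2023, Prop. 2.2 (proof, p. 17)] -/
theorem subst_invOnePlusSubOne_eq_of_iwasawaToPowerSeries_eq {L : ℚ_[p]⟦X⟧} {w : ℤ} {c : ℤ_[p]}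
    (hFE : L.subst (invOnePlusSubOne : ℚ_[p]⟦X⟧) =
      C ((w : ℤ) : ℚ_[p]) * PowerSeries.binomialSeries ℚ_[p] c * L)
    {b : IwasawaAlgebra p} {t : ℚ_[p]} (hb : iwasawaToPowerSeries p b = C t * L) :
    b.subst (invOnePlusSubOne : ℤ_[p]⟦X⟧) =
      C ((w : ℤ) : ℤ_[p]) * PowerSeries.binomialSeries ℤ_[p] c * b := by
  apply iwasawaToPowerSeries_injective p
  -- left-hand side: `ι(b(T^ι)) = (ι b)(T^ι) = (t L)(T^ι) = t · L(T^ι)`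
  have hm := map_subst (hasSubst_invOnePlusSubOne (R := ℤ_[p])) (h := algebraMap ℤ_[p] ℚ_[p]) b
  have hι : MvPowerSeries.map (algebraMap ℤ_[p] ℚ_[p]) (invOnePlusSubOne : ℤ_[p]⟦X⟧) =
      (invOnePlusSubOne : ℚ_[p]⟦X⟧) :=
    map_invOnePlusSubOne (algebraMap ℤ_[p] ℚ_[p])
  rw [hι] at hm
  change iwasawaToPowerSeries p (b.subst invOnePlusSubOne) =
    (iwasawaToPowerSeries p b).subst _ at hm
  have hL : (iwasawaToPowerSeries p b).subst (invOnePlusSubOne : ℚ_[p]⟦X⟧) =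
      C t * (C ((w : ℤ) : ℚ_[p]) * PowerSeries.binomialSeries ℚ_[p] c * L) := by
    rw [hb, ← smul_eq_C_mul, subst_smul hasSubst_invOnePlusSubOne t L, hFE, smul_eq_C_mul]
  rw [hm, hL, map_mul, map_mul, iwasawaToPowerSeries_binomialSeries, hb]
  have hC : iwasawaToPowerSeries p (C ((w : ℤ) : ℤ_[p])) = C ((w : ℤ) : ℚ_[p]) := by
    change PowerSeries.map (algebraMap ℤ_[p] ℚ_[p]) _ = _
    rw [map_C, map_intCast]
  rw [hC]
  ring

/-- **Reduction modulo `p`.** From `b(T^ι) = w (1+T)^c b` in `Λ`: the reduction `b̄ ∈ 𝔽_p⟦T⟧`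
satisfies `b̄(T^ι) = w̄ · ū · b̄` with `ū = (1+T)^c mod p`, `ū(0) = 1`.
[cite: BurungaleSkinner2023, Prop. 2.2 (proof, p. 17: "(2.2) … (mod p^{μ+1})")] -/
theorem subst_invOnePlusSubOne_map_toZMod {b : IwasawaAlgebra p} {w : ℤ} {c : ℤ_[p]}
    (hFE : b.subst (invOnePlusSubOne : ℤ_[p]⟦X⟧) =
      C ((w : ℤ) : ℤ_[p]) * PowerSeries.binomialSeries ℤ_[p] c * b) :
    (PowerSeries.map (PadicInt.toZMod (p := p)) b).subst (invOnePlusSubOne : (ZMod p)⟦X⟧) =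
      C ((w : ℤ) : ZMod p) *
        PowerSeries.map (PadicInt.toZMod (p := p)) (PowerSeries.binomialSeries ℤ_[p] c) *
        PowerSeries.map (PadicInt.toZMod (p := p)) b := by
  have h := subst_invOnePlusSubOne_map (PadicInt.toZMod (p := p)) hFE
  rw [map_intCast] at h
  exact h

/-- The reduced multiplier `(1+T)^c mod p` has constant term `1` (the `v(T)` with unit constant term
of the printed proof). [cite: BurungaleSkinner2023, Prop. 2.2 (proof, p. 17)] -/
theorem constantCoeff_map_toZMod_binomialSeries (c : ℤ_[p]) :
    constantCoeff (PowerSeries.map (PadicInt.toZMod (p := p)) (PowerSeries.binomialSeries ℤ_[p] c))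
      = 1 := by
  rw [← coeff_zero_eq_constantCoeff_apply, coeff_map, coeff_zero_eq_constantCoeff_apply,
    binomialSeries_constantCoeff, map_one]

end Descent

/-! ### Proposition 2.2: `ε(E) = (−1)^{λ(L_E)}` -/

section RootNumber

variable {p : ℕ} [Fact p.Prime] {W : WeierstrassCurve ℚ} [W.IsElliptic] [W.IsGloballyMinimal]
  [NeZero (W.conductorNorm ℤ)] {f : CuspForm (Gamma0 (W.conductorNorm ℤ)) 2}

/-- `±1` read in `𝔽_p`, `p` odd: `(w : 𝔽_p) = (−1)^n` forces `w = (−1)^n` in `ℤ` for `w ∈ {±1}`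
(`1 ≠ −1` in `𝔽_p` as `p ∤ 2`). [folklore] -/
private theorem int_eq_neg_one_pow_of_cast_eq (hp : p ≠ 2) {w : ℤ} (hw : w = 1 ∨ w = -1) {n : ℕ}
    (h : ((w : ℤ) : ZMod p) = (-1) ^ n) : w = (-1) ^ n := by
  have h2 : (2 : ZMod p) ≠ 0 := by
    intro h0
    have hdvd : p ∣ 2 := by
      have : ((2 : ℕ) : ZMod p) = 0 := by exact_mod_cast h0
      exact (ZMod.natCast_eq_zero_iff 2 p).mp this
    have hp2 : p ≤ 2 := Nat.le_of_dvd (by norm_num) hdvd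
    have hp1 : 2 ≤ p := (Fact.out : p.Prime).two_le
    omega
  have hne : (1 : ZMod p) ≠ -1 := by
    intro h1
    apply h2
    linear_combination h1
  rcases Nat.even_or_odd n with hn | hn
  · rw [hn.neg_one_pow] at h ⊢
    rcases hw with rfl | rfl
    · rfl
    · exfalso
      push_cast at h
      exact hne h.symm
  · rw [hn.neg_one_pow] at h ⊢
    rcases hw with rfl | rfl
    · exfalso
      push_cast at h
      exact hne h
    · rfl

/-- **Burungale–Skinner 2023, Proposition 2.2 — PROVED: `ε(E) = (−1)^{λ(L_E)}`** (p. 17: "The root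
number `ε(E)` of `E` equals `(−1)^{λ(L_E)}`"), in the tree's `μ = 0` currency and for every integral
rescaling of the `p`-adic `L`-function. Let `W/ℚ` be a globally minimal elliptic curve, `p` an ODD
prime of good ordinary reduction, `f ∈ S₂(Γ₀(N_W))` the newform of `W`, `α = unitRoot W p`, and
`b ∈ Λ = ℤ_p⟦T⟧` with `ι b = t · L_p(f, α, T)` (`t ∈ ℚ_p`; e.g. the Néron normalisation
`t = ϖ`, `ϖ Ω_E = Ω⁺_f`, of BS §2.1.1 / Greenberg–Vatsal §3) and unit content (`μ(b) = 0`, so that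
`λ(b) = ord_T(b mod p)`). Then `w_E = (−1)^{ord_T(b mod p)}`. Proof as printed: the functional
equation `L_p(E,T^ι) = w_E (1+T)^c L_p(E,T)` (tree theorem
`padicLFunction_mem_padicFEClass_rootNumber_conductorLevel`) descends to `Λ`
(`subst_invOnePlusSubOne_eq_of_iwasawaToPowerSeries_eq`), reduces modulo `p`
(`subst_invOnePlusSubOne_map_toZMod`), and in the domain `𝔽_p⟦T⟧` the coefficients of `T^λ`
give `w̄_E = (−1)^λ` (`eq_neg_one_pow_of_subst_eq`, `T^ι = −T + O(T²)`); finally `p ≠ 2` lifts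
the identity to `ℤ`. [cite: BurungaleSkinner2023, Prop. 2.2 (p. 17)]
[cite: GreenbergLNM1716, §1 (functional equation, pp. 67–68)] -/
theorem rootNumber_eq_neg_one_pow_order_map_toZMod (hp : p ≠ 2) (hord : IsOrdinaryAt W p)
    (hf : IsNewformOf W f) {t : ℚ_[p]} {b : IwasawaAlgebra p}
    (hb : iwasawaToPowerSeries p b = C t * padicLFunction f (unitRoot W p : ℚ_[p]))
    (hμ : HasUnitContent b) :
    W.rootNumber = (-1) ^ (PowerSeries.map (PadicInt.toZMod (p := p)) b).order.toNat := by
  obtain ⟨u, ⟨c, rfl⟩, hFE⟩ := padicLFunction_mem_padicFEClass_rootNumber_conductorLevel hord hf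
  -- descend to `Λ`, reduce modulo `p`
  have hΛ := subst_invOnePlusSubOne_eq_of_iwasawaToPowerSeries_eq hFE hb
  have hmod := subst_invOnePlusSubOne_map_toZMod hΛ
  -- the reduction is non-zero (`μ = 0`), so its `T`-order is a natural number
  have hne : PowerSeries.map (PadicInt.toZMod (p := p)) b ≠ 0 :=
    (hasUnitContent_iff_map_toZMod_ne_zero b).mp hμ
  have hord' : (PowerSeries.map (PadicInt.toZMod (p := p)) b).order =
      ((PowerSeries.map (PadicInt.toZMod (p := p)) b).order.toNat : ℕ) :=
    (ENat.coe_toNat (order_eq_top.not.mpr hne)).symm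
  -- leading coefficients in the domain `𝔽_p⟦T⟧`
  have key := eq_neg_one_pow_of_subst_eq (R := ZMod p) constantCoeff_invOnePlusSubOne
    coeff_one_invOnePlusSubOne (constantCoeff_map_toZMod_binomialSeries c) hmod hord'
  exact int_eq_neg_one_pow_of_cast_eq hp W.rootNumber_eq_one_or key

/-- **Corollary: `λ(L_E)` even iff `w_E = +1`** (same hypotheses). [cite: BurungaleSkinner2023, Prop. 2.2 (p. 17)] -/
theorem even_order_map_toZMod_iff_rootNumber_eq_one (hp : p ≠ 2) (hord : IsOrdinaryAt W p)
    (hf : IsNewformOf W f) {t : ℚ_[p]} {b : IwasawaAlgebra p}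
    (hb : iwasawaToPowerSeries p b = C t * padicLFunction f (unitRoot W p : ℚ_[p]))
    (hμ : HasUnitContent b) :
    Even (PowerSeries.map (PadicInt.toZMod (p := p)) b).order.toNat ↔ W.rootNumber = 1 := by
  have h := rootNumber_eq_neg_one_pow_order_map_toZMod hp hord hf hb hμ
  constructor
  · intro he; rw [h, he.neg_one_pow]
  · intro h1
    by_contra hodd
    rw [Nat.not_even_iff_odd] at hodd
    rw [hodd.neg_one_pow] at h
    rw [h] at h1
    norm_num at h1

/-- **Corollary: `λ(L_E) ≡ ord_{s=1} L(E,s) (mod 2)`** — `λ` has the parity of the analytic rank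
(both parities are the sign `w_E`: Prop. 2.2 for `λ`, Hecke's functional equation for `ord_{s=1}`,
tree `even_analyticRank_iff_of_isNewformOf_conductorLevel`). BS p. 14: "in general it is only known
that each order of vanishing has the same parity". [cite: BurungaleSkinner2023, Prop. 2.2 (p. 17) and p. 14] -/
theorem even_order_map_toZMod_iff_even_analyticRank (hp : p ≠ 2) (hord : IsOrdinaryAt W p)
    (hf : IsNewformOf W f) {t : ℚ_[p]} {b : IwasawaAlgebra p}
    (hb : iwasawaToPowerSeries p b = C t * padicLFunction f (unitRoot W p : ℚ_[p]))
    (hμ : HasUnitContent b) :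
    Even (PowerSeries.map (PadicInt.toZMod (p := p)) b).order.toNat ↔ Even W.analyticRank := by
  rw [even_order_map_toZMod_iff_rootNumber_eq_one hp hord hf hb hμ,
    even_analyticRank_iff_of_isNewformOf_conductorLevel hf]

/-- **The instance used in the proof of Thm. 2.8 (p. 21): `λ(L_E) = 1 ⇒ ε(E) = −1`** ("As
`λ(L_{E^ψ}) = 1`, it follows from Proposition 2.2 that `ε(E^ψ) = −1`"), and hence `ord_{s=1} L(E,s)`
is odd. [cite: BurungaleSkinner2023, proof of Thm. 2.8 (p. 21)] -/
theorem rootNumber_eq_neg_one_of_order_map_toZMod_eq_one (hp : p ≠ 2) (hord : IsOrdinaryAt W p)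
    (hf : IsNewformOf W f) {t : ℚ_[p]} {b : IwasawaAlgebra p}
    (hb : iwasawaToPowerSeries p b = C t * padicLFunction f (unitRoot W p : ℚ_[p]))
    (h1 : (PowerSeries.map (PadicInt.toZMod (p := p)) b).order = 1) :
    W.rootNumber = -1 ∧ Odd W.analyticRank := by
  have hμ : HasUnitContent b := by
    rw [hasUnitContent_iff_map_toZMod_ne_zero]
    intro h0
    rw [h0, order_zero] at h1
    exact ENat.top_ne_coe 1 h1
  have h := rootNumber_eq_neg_one_pow_order_map_toZMod hp hord hf hb hμ
  have h1' : (PowerSeries.map (PadicInt.toZMod (p := p)) b).order.toNat = 1 := by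
    rw [h1]; rfl
  rw [h1', pow_one] at h
  refine ⟨h, ?_⟩
  have hpar : Even W.analyticRank ↔ W.rootNumber = 1 :=
    even_analyticRank_iff_of_isNewformOf_conductorLevel hf
  rw [← Nat.not_even_iff_odd, hpar, h]
  norm_num

end RootNumber

end Literature.NumberTheory.EllipticCurves.BurungaleSkinner2023

end
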